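import Mathlib.Analysis.MeanInequalities
import Mathlib.Analysis.SpecialFunctions.Pow.Real
import Literature.Computability.Cryptography.EncryptionSchemes
import Literature.Computability.Cryptography.StatisticalDistanceISupMeasure
import HarnessLib

/-!
# Short keys: multiple encryptions under one private key are statistically distinguishable

Companion of `EncryptionSchemes.lean` (`SKEScheme`, `ctVecPMF`, `encVecPMF`,
`HasIndMultipleEncryptions`, `SecureSKEExist`). Everything here is unconditional and
information-theoretic (no complexity bounds on the observer): it is the quantitative reason why
`SecureSKEExist` — indistinguishable encryptions of *arbitrarily (polynomially) many* messages
under one key produced from `q(n)` coins — can only hold computationally, i.e. why it is an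
intractability assumption (Shannon 1949: perfect secrecy needs as much key as plaintext;
Arora–Barak 2009, §9.1 and Lemma 9.2: with keys shorter than the plaintext, `P = NP` breaks every
polynomial-time scheme; Goldreich 2004, §5.5.7 Exercise 2, guideline: the two ensembles "are
statistically far apart … because `Kₙ` may contain at most `n` bits of information").

## The bound (spurious keys, after Shannon's unicity argument)

Fix a scheme `S = (G, E, D)`, any string `k` (the key in use), any string `k'` (a candidate key),
`t` pairwise **distinct** plaintexts `ū = (u₁, …, u_t)` and one plaintext `v`. Encrypt `v` `t` times
independently under `k`: `c̄ ← Ē_k(v, …, v)` (`ctVecPMF`). The events `{D_{k'}(c) = uᵢ}`, `i ≤ t`, are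
pairwise disjoint for a single ciphertext `c ← E_k(v)`, so their probabilities `pᵢ` sum to `≤ 1`,
and by independence and the AM–GM inequality

  `Pr[∀ i, D_{k'}(cᵢ) = uᵢ] = ∏ᵢ pᵢ ≤ (∑ᵢ pᵢ / t)ᵗ ≤ t⁻ᵗ`           (`toOuterMeasure_spuriousKey_le`).

Hence for a finite set `K` of candidate keys, `Pr[∃ k' ∈ K, ∀ i, D_{k'}(cᵢ) = uᵢ] ≤ |K|·t⁻ᵗ`
(`toOuterMeasure_exists_spuriousKey_le`, and under a fresh key `toOuterMeasure_encVecPMF_spurious_le`),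
whereas if `S` is correct and `K ⊇ supp G(1ⁿ)` the same event has probability `1` under
`Ē_{G(1ⁿ)}(ū)` (`toOuterMeasure_encVecPMF_dec_eq_one`). Since `|supp G(1ⁿ)| ≤ 2^{q(n)}` with
`q(n)` the coin budget of `G` (`exists_finset_keyPMF_support`), the statistical distance between the
encryptions of `ū` and of `(v, …, v)` is `≥ 1 − 2^{q(n)} t⁻ᵗ` (`le_tvDist_encVecPMF`), in particular
`≥ 3/4` as soon as `t ≥ q(n) + 2` (`three_quarters_le_tvDist_encVecPMF`): **no correct private-key
scheme has statistically close encryptions of `q(n) + 2` messages**, whatever the (randomised)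
encryption algorithm and the key distribution. The test "does some key of the key space decrypt
every component to the announced plaintext?" uses decryption only; unlike the range test
`y ∈ supp E_{Uₙ}(0^m)` of Arora–Barak's proof of Lemma 9.2 (stated there for encryption that is
deterministic given the key), it needs neither the encryption coins nor their number, which in the
tree's `RandAlg` model is an arbitrary (possibly non-computable) function `coinLen`.

## Main statements

* `SKEScheme.mem_support_ctVecPMF_iff`, `SKEScheme.toOuterMeasure_ctVecPMF_forall₂`,
  `SKEScheme.toOuterMeasure_ctVecPMF_replicate` — support and product law of `ctVecPMF` on
  rectangle events;
* `sum_toOuterMeasure_fiber_le_one`, `prod_le_inv_card_pow`, `prod_toOuterMeasure_fiber_le` — the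
  AM–GM step for the fibres of any map under a `PMF`;
* `SKEScheme.toOuterMeasure_spuriousKey_le`, `SKEScheme.toOuterMeasure_exists_spuriousKey_le`,
  `SKEScheme.toOuterMeasure_encVecPMF_spurious_le`, `SKEScheme.toOuterMeasure_encVecPMF_dec_eq_one`,
  `SKEScheme.exists_finset_keyPMF_support`;
* `SKEScheme.le_tvDist_encVecPMF`, `SKEScheme.three_quarters_le_tvDist_encVecPMF`.

## Design notes

* Events on ciphertext vectors are written with `List.Forall₂` (componentwise relation with the
  list of targets); the encoded law `encVecPMF` is reached through the injective coding
  `(encodingList Bool).listBool.encode` (`toOuterMeasure_encVecPMF_image`).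
* No new definition and no named fact; the file only proves theorems about the notions of
  `EncryptionSchemes.lean`. The computational counterpart (Arora–Barak's Lemma 9.2 in the tree's
  model: `NP ⊆ P → ¬ SecureSKEExist`, by running the above test with a polynomial-time witness
  search, `exists_searchFn_of_NP_subset_P` of `Complexity/SearchToDecision.lean`) is not in this file.

## References

* C. E. Shannon, *Communication theory of secrecy systems*, Bell System Tech. J. 28 (1949),
  §10 (Thm. 6: perfect secrecy requires `H(K) ≥ H(M)`), §§14–15 (equivocation, unicity distance).
* S. Arora, B. Barak, *Computational Complexity: A Modern Approach*, CUP 2009, §9.1 (Def. 9.1,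
  Exercise 9.2) and §9.2, Lemma 9.2 with its proof.
* O. Goldreich, *Foundations of Cryptography II: Basic Applications*, CUP 2004, §5.5.7,
  Exercise 2 (guideline) and Exercise 3.
-/

namespace Literature.Computability.Cryptography

open Filter Asymptotics _root_.Computability Complexity
open scoped ENNReal

/-! ### An elementary fact about probability mass functions

(The bound `p.toOuterMeasure s ≤ 1` is used inline — monotonicity to `Set.univ` and
`PMF.toOuterMeasure_apply_eq_one_iff`; the tree states it as `pmf_toOuterMeasure_apply_le_one` in
`CommitmentsSignatures.lean`, which is not imported here.) -/

/-- The fibres of a map carry total mass at most `1`: `∑_{u ∈ U} Pr_p[d = u] ≤ 1` for every finite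
set `U` of values. [folklore] -/
theorem sum_toOuterMeasure_fiber_le_one {α β : Type*} (p : PMF α) (d : α → β) (U : Finset β) :
    ∑ u ∈ U, p.toOuterMeasure (d ⁻¹' {u}) ≤ 1 := by
  calc ∑ u ∈ U, p.toOuterMeasure (d ⁻¹' {u}) = ∑ u ∈ U, p.map d u := by
        refine Finset.sum_congr rfl fun u _ => ?_
        rw [← PMF.toOuterMeasure_map_apply, PMF.toOuterMeasure_apply_singleton]
    _ ≤ ∑' u, p.map d u := ENNReal.sum_le_tsum U
    _ = 1 := (p.map d).tsum_coe

/-! ### The AM–GM step -/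

/-- **AM–GM in the form used for spurious keys**: nonnegative reals indexed by a finite set of
size `t` whose sum is at most `1` have product at most `t⁻ᵗ` (weighted AM–GM with equal weights,
Mathlib's `Real.geom_mean_le_arith_mean_weighted`). [folklore] -/
theorem prod_le_inv_card_pow {ι : Type*} (s : Finset ι) (f : ι → ℝ) (h0 : ∀ i ∈ s, 0 ≤ f i)
    (h1 : ∑ i ∈ s, f i ≤ 1) : ∏ i ∈ s, f i ≤ ((s.card : ℝ)⁻¹) ^ s.card := by
  rcases s.eq_empty_or_nonempty with rfl | hs
  · simp
  have htpos : (0 : ℝ) < s.card := by exact_mod_cast hs.card_pos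
  have hw : ∑ i ∈ s, (fun _ => (s.card : ℝ)⁻¹) i = 1 := by
    rw [Finset.sum_const, nsmul_eq_mul, mul_inv_cancel₀ htpos.ne']
  have hamgm := Real.geom_mean_le_arith_mean_weighted s (fun _ => (s.card : ℝ)⁻¹) f
    (fun _ _ => inv_nonneg.2 htpos.le) hw h0
  rw [Real.finsetProd_rpow s f h0, ← Finset.mul_sum] at hamgm
  have hle : (∏ i ∈ s, f i) ^ (s.card : ℝ)⁻¹ ≤ (s.card : ℝ)⁻¹ :=
    hamgm.trans (mul_le_of_le_one_right (inv_nonneg.2 htpos.le) h1)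
  have hP : 0 ≤ ∏ i ∈ s, f i := Finset.prod_nonneg h0
  calc ∏ i ∈ s, f i = ((∏ i ∈ s, f i) ^ (s.card : ℝ)⁻¹) ^ s.card :=
        (Real.rpow_inv_natCast_pow hP hs.card_pos.ne').symm
    _ ≤ ((s.card : ℝ)⁻¹) ^ s.card := pow_le_pow_left₀ (Real.rpow_nonneg hP _) hle _

/-- **Product of fibre masses**: for a `PMF` `p`, a map `d` and a finite set `U` of `t` values,
`∏_{u ∈ U} Pr_p[d = u] ≤ t⁻ᵗ` (the fibres are disjoint, so the masses sum to `≤ 1`; then AM–GM).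
[folklore] -/
theorem prod_toOuterMeasure_fiber_le {α β : Type*} (p : PMF α) (d : α → β) (U : Finset β) :
    ∏ u ∈ U, p.toOuterMeasure (d ⁻¹' {u}) ≤ ENNReal.ofReal (((U.card : ℝ)⁻¹) ^ U.card) := by
  have hfin : ∀ u ∈ U, p.toOuterMeasure (d ⁻¹' {u}) ≠ ∞ := fun u _ =>
    ne_top_of_le_ne_top ENNReal.one_ne_top
      ((p.toOuterMeasure.mono (Set.subset_univ _)).trans_eq
        ((PMF.toOuterMeasure_apply_eq_one_iff p _).2 (Set.subset_univ _)))
  rw [← ENNReal.ofReal_toReal (ENNReal.prod_ne_top hfin), ENNReal.toReal_prod]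
  refine ENNReal.ofReal_le_ofReal (prod_le_inv_card_pow U _ (fun _ _ => ENNReal.toReal_nonneg) ?_)
  rw [← ENNReal.toReal_sum hfin]
  exact ENNReal.toReal_le_of_le_ofReal zero_le_one
    (by simpa only [ENNReal.ofReal_one] using sum_toOuterMeasure_fiber_le_one p d U)

/-! ### Support and product law of the ciphertext-vector distribution -/

namespace SKEScheme

variable (S : SKEScheme) (k : List Bool)

/-- **Support of the ciphertext vector**: `c̄` is a possible value of `Ē_k(m̄)` iff it has the
right length and each component is a possible value of `E_k(mᵢ)` (independent fresh coins per
component). [Goldreich 2004, Def. 5.2.8 (`Ē_e(x̄)`); Mathlib `PMF.mem_support_bind_iff`,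
`PMF.support_map`] [cite: Goldreich2004, Def. 5.2.8] -/
theorem mem_support_ctVecPMF_iff :
    ∀ (ms : List (List Bool)) (cs : List (List Bool)),
      cs ∈ (S.ctVecPMF k ms).support ↔ List.Forall₂ (fun c m => c ∈ (S.ctPMF k m).support) cs ms
  | [], cs => by
    simp only [ctVecPMF, PMF.support_pure, Set.mem_singleton_iff, List.forall₂_nil_right_iff]
  | m :: ms, cs => by
    rw [ctVecPMF, PMF.mem_support_bind_iff]
    simp only [PMF.support_map, Set.mem_image, List.forall₂_cons_right_iff]
    constructor
    · rintro ⟨c, hc, cs', hcs', rfl⟩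
      exact ⟨c, cs', hc, (mem_support_ctVecPMF_iff ms cs').1 hcs', rfl⟩
    · rintro ⟨c, cs', hc, hcs', rfl⟩
      exact ⟨c, hc, cs', (mem_support_ctVecPMF_iff ms cs').2 hcs', rfl⟩

/-- `zipWith f (v, …, v) T = T.map (f v)`. [folklore] -/
private theorem zipWith_replicate_length {α β γ : Type*} (f : α → β → γ) (v : α) :
    ∀ T : List β, List.zipWith f (List.replicate T.length v) T = T.map (f v)
  | [] => rfl
  | b :: T => by
    rw [List.length_cons, List.replicate_succ, List.zipWith_cons_cons, List.map_cons,
      zipWith_replicate_length f v T]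

/-- **Product law of `Ē_k` on rectangles**: for target sets `T = (A₁, …, A_t)`,
`Pr[∀ i, cᵢ ∈ Aᵢ] = ∏ᵢ Pr_{E_k(mᵢ)}[Aᵢ]` — the components of the ciphertext vector are independent
(fresh coins per component). [Goldreich 2004, Def. 5.2.8 (`Ē_e(x̄)` with independent coins);
Mathlib `PMF.toOuterMeasure_bind_apply`] [cite: Goldreich2004, Def. 5.2.8] -/
theorem toOuterMeasure_ctVecPMF_forall₂ :
    ∀ (ms : List (List Bool)) (T : List (Set (List Bool))), ms.length = T.length →
      (S.ctVecPMF k ms).toOuterMeasure {cs | List.Forall₂ (· ∈ ·) cs T} =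
        (List.zipWith (fun m A => (S.ctPMF k m).toOuterMeasure A) ms T).prod
  | [], [], _ => by
    rw [ctVecPMF, PMF.toOuterMeasure_pure_apply, if_pos (by exact List.Forall₂.nil)]
    rfl
  | [], _ :: _, h => absurd h (by simp)
  | _ :: _, [], h => absurd h (by simp)
  | m :: ms, A :: T, h => by
    have ih := toOuterMeasure_ctVecPMF_forall₂ ms T (by simpa using h)
    rw [ctVecPMF, PMF.toOuterMeasure_bind_apply, List.zipWith_cons_cons, List.prod_cons, ← ih,
      PMF.toOuterMeasure_apply (S.ctPMF k m) A, ← ENNReal.tsum_mul_right]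
    refine tsum_congr fun c => ?_
    rw [PMF.toOuterMeasure_map_apply]
    by_cases hc : c ∈ A
    · rw [Set.indicator_of_mem hc]
      congr 2
      ext cs
      simp only [Set.mem_preimage, Set.mem_setOf_eq, List.forall₂_cons, hc, true_and]
    · rw [Set.indicator_of_notMem hc, zero_mul]
      have he : (fun cs : List (List Bool) => c :: cs) ⁻¹' {cs | List.Forall₂ (· ∈ ·) cs (A :: T)} = ∅ := by
        ext cs
        simp only [Set.mem_preimage, Set.mem_setOf_eq, List.forall₂_cons, hc, false_and,
          Set.mem_empty_iff_false]
      rw [he, MeasureTheory.measure_empty, mul_zero]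

/-- **Independent encryptions of one plaintext**: for `c̄ ← Ē_k(v, …, v)` (`t = |T|` copies) and
target sets `T = (A₁, …, A_t)`, `Pr[∀ i, cᵢ ∈ Aᵢ] = ∏ᵢ Pr_{E_k(v)}[Aᵢ]`.
[Goldreich 2004, Def. 5.2.8] [cite: Goldreich2004, Def. 5.2.8] -/
theorem toOuterMeasure_ctVecPMF_replicate (v : List Bool) (T : List (Set (List Bool))) :
    (S.ctVecPMF k (List.replicate T.length v)).toOuterMeasure {cs | List.Forall₂ (· ∈ ·) cs T} =
      (T.map fun A => (S.ctPMF k v).toOuterMeasure A).prod := by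
  rw [S.toOuterMeasure_ctVecPMF_forall₂ k _ T (List.length_replicate ..),
    zipWith_replicate_length]

/-- **Correct keys decrypt every component** (probability one): if `S` is correct and `k` is in
the range of `G(1ⁿ)`, then `c̄ ← Ē_k(ū)` satisfies `D_k(cᵢ) = uᵢ` for all `i` almost surely.
[Goldreich 2004, Def. 5.1.1 (2) with Def. 5.2.8] [cite: Goldreich2004, Def. 5.1.1] -/
theorem toOuterMeasure_ctVecPMF_dec_eq_one {S : SKEScheme} (hS : S.IsCorrect) {n : ℕ}
    {k : List Bool} (hk : k ∈ (S.keyPMF n).support) (us : List (List Bool)) :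
    (S.ctVecPMF k us).toOuterMeasure {cs | List.Forall₂ (fun c u => S.dec k c = some u) cs us} = 1 := by
  rw [PMF.toOuterMeasure_apply_eq_one_iff]
  intro cs hcs
  exact ((S.mem_support_ctVecPMF_iff k us cs).1 hcs).imp fun c u hc => hS n k hk u c hc

/-! ### Spurious keys -/

/-- **One candidate key, general form**: for any map `d` on ciphertexts (e.g. `D_{k'}`) and
pairwise distinct targets `w₁, …, w_t`, `t` independent encryptions of one plaintext `v` under
`k` hit the targets componentwise (`d cᵢ = wᵢ` for all `i`) with probability at most `t⁻ᵗ`.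
[Shannon 1949, §§14–15 (spurious keys / unicity); here: disjoint fibres and AM–GM] [folklore] -/
theorem toOuterMeasure_ctVecPMF_replicate_fibers_le {β : Type} (v : List Bool) (d : List Bool → β)
    (ws : List β) (hws : ws.Nodup) :
    (S.ctVecPMF k (List.replicate ws.length v)).toOuterMeasure
        {cs | List.Forall₂ (fun c w => d c = w) cs ws} ≤
      ENNReal.ofReal (((ws.length : ℝ)⁻¹) ^ ws.length) := by
  classical
  have hT : {cs | List.Forall₂ (fun c w => d c = w) cs ws} =
      {cs | List.Forall₂ (· ∈ ·) cs (ws.map fun w => d ⁻¹' {w})} := by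
    ext cs
    simp only [Set.mem_setOf_eq, List.forall₂_map_right_iff, Set.mem_preimage,
      Set.mem_singleton_iff]
  have hprod := S.toOuterMeasure_ctVecPMF_replicate k v (ws.map fun w => d ⁻¹' {w})
  rw [List.length_map] at hprod
  rw [hT, hprod, List.map_map]
  have hfin : (ws.map ((fun A => (S.ctPMF k v).toOuterMeasure A) ∘ fun w => d ⁻¹' {w})).prod =
      ∏ w ∈ ws.toFinset, (S.ctPMF k v).toOuterMeasure (d ⁻¹' {w}) :=
    (List.prod_toFinset _ hws).symm
  rw [hfin, ← List.toFinset_card_of_nodup hws]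
  exact prod_toOuterMeasure_fiber_le _ d ws.toFinset

/-- **Spurious-key bound** (one candidate key): for any strings `k` (key in use) and `k'`
(candidate), pairwise distinct plaintexts `ū = (u₁, …, u_t)` and a plaintext `v`,
`Pr_{c̄ ← Ē_k(v,…,v)}[∀ i, D_{k'}(cᵢ) = uᵢ] ≤ t⁻ᵗ`. No correctness or efficiency is assumed.
[Shannon 1949, §§14–15; Arora–Barak 2009, proof of Lemma 9.2 (counting over one key)] [folklore] -/
theorem toOuterMeasure_spuriousKey_le (k' v : List Bool) (us : List (List Bool)) (hus : us.Nodup) :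
    (S.ctVecPMF k (List.replicate us.length v)).toOuterMeasure
        {cs | List.Forall₂ (fun c u => S.dec k' c = some u) cs us} ≤
      ENNReal.ofReal (((us.length : ℝ)⁻¹) ^ us.length) := by
  have h := S.toOuterMeasure_ctVecPMF_replicate_fibers_le k v (S.dec k') (us.map some)
    (hus.map (Option.some_injective _))
  rw [List.length_map] at h
  have hE : {cs | List.Forall₂ (fun c u => S.dec k' c = some u) cs us} =
      {cs | List.Forall₂ (fun c w => S.dec k' c = w) cs (us.map some)} := by
    ext cs
    simp only [Set.mem_setOf_eq, List.forall₂_map_right_iff]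
  rwa [hE]

/-- **Spurious-key bound, finitely many candidates**: for a finite set `K` of candidate keys,
`Pr_{c̄ ← Ē_k(v,…,v)}[∃ k' ∈ K, ∀ i, D_{k'}(cᵢ) = uᵢ] ≤ |K|·t⁻ᵗ` (union bound).
[Shannon 1949, §§14–15; Arora–Barak 2009, proof of Lemma 9.2] [folklore] -/
theorem toOuterMeasure_exists_spuriousKey_le (v : List Bool) (us : List (List Bool))
    (hus : us.Nodup) (K : Finset (List Bool)) :
    (S.ctVecPMF k (List.replicate us.length v)).toOuterMeasure
        {cs | ∃ k' ∈ K, List.Forall₂ (fun c u => S.dec k' c = some u) cs us} ≤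
      K.card * ENNReal.ofReal (((us.length : ℝ)⁻¹) ^ us.length) := by
  have hU : {cs | ∃ k' ∈ K, List.Forall₂ (fun c u => S.dec k' c = some u) cs us} =
      ⋃ k' ∈ K, {cs | List.Forall₂ (fun c u => S.dec k' c = some u) cs us} := by
    ext cs
    simp only [Set.mem_setOf_eq, Set.mem_iUnion, exists_prop]
  rw [hU]
  refine (MeasureTheory.measure_biUnion_finset_le K _).trans ?_
  calc ∑ k' ∈ K, (S.ctVecPMF k (List.replicate us.length v)).toOuterMeasure
          {cs | List.Forall₂ (fun c u => S.dec k' c = some u) cs us}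
        ≤ ∑ _k' ∈ K, ENNReal.ofReal (((us.length : ℝ)⁻¹) ^ us.length) :=
          Finset.sum_le_sum fun k' _ => S.toOuterMeasure_spuriousKey_le k k' v us hus
    _ = K.card * ENNReal.ofReal (((us.length : ℝ)⁻¹) ^ us.length) := by
          rw [Finset.sum_const, nsmul_eq_mul]

/-! ### Under a fresh key: the encoded ciphertext-vector law `encVecPMF` -/

/-- Events on the encoded ciphertext vector are events on the vector (the coding
`listBool.encode` is injective), averaged over the key:
`Pr_{encVecPMF n m̄}[code(E)] = ∑ₖ Pr[G(1ⁿ) = k] · Pr_{Ē_k(m̄)}[E]`.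
[Goldreich 2004, Def. 5.2.8; Mathlib `PMF.toOuterMeasure_bind_apply`] [cite: Goldreich2004, Def. 5.2.8] -/
theorem toOuterMeasure_encVecPMF_image (n : ℕ) (ms : List (List Bool)) (E : Set (List (List Bool))) :
    (S.encVecPMF n ms).toOuterMeasure ((encodingList Bool).listBool.encode '' E) =
      ∑' k, S.keyPMF n k * (S.ctVecPMF k ms).toOuterMeasure E := by
  rw [encVecPMF, PMF.toOuterMeasure_bind_apply]
  refine tsum_congr fun k => ?_
  rw [PMF.toOuterMeasure_map_apply,
    Set.preimage_image_eq _ (encodingList Bool).listBool.encode_injective]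

/-- **Spurious-key bound under a fresh key**: for `c̄ ← Ē_{G(1ⁿ)}(v, …, v)`,
`Pr[∃ k' ∈ K, ∀ i, D_{k'}(cᵢ) = uᵢ] ≤ |K|·t⁻ᵗ` for every finite `K` and pairwise distinct `ū`.
[Shannon 1949, §§14–15; Arora–Barak 2009, proof of Lemma 9.2] [folklore] -/
theorem toOuterMeasure_encVecPMF_spurious_le (n : ℕ) (v : List Bool) (us : List (List Bool))
    (hus : us.Nodup) (K : Finset (List Bool)) :
    (S.encVecPMF n (List.replicate us.length v)).toOuterMeasure
        ((encodingList Bool).listBool.encode ''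
          {cs | ∃ k' ∈ K, List.Forall₂ (fun c u => S.dec k' c = some u) cs us}) ≤
      K.card * ENNReal.ofReal (((us.length : ℝ)⁻¹) ^ us.length) := by
  rw [toOuterMeasure_encVecPMF_image]
  calc ∑' k, S.keyPMF n k * (S.ctVecPMF k (List.replicate us.length v)).toOuterMeasure
          {cs | ∃ k' ∈ K, List.Forall₂ (fun c u => S.dec k' c = some u) cs us}
        ≤ ∑' k, S.keyPMF n k * (K.card * ENNReal.ofReal (((us.length : ℝ)⁻¹) ^ us.length)) :=
          ENNReal.tsum_le_tsum fun k => by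
            gcongr
            exact S.toOuterMeasure_exists_spuriousKey_le k v us hus K
    _ = K.card * ENNReal.ofReal (((us.length : ℝ)⁻¹) ^ us.length) := by
          rw [ENNReal.tsum_mul_right, PMF.tsum_coe, one_mul]

/-- **The genuine key is found** (probability one): if `S` is correct and `K` contains the range
of `G(1ⁿ)`, then `c̄ ← Ē_{G(1ⁿ)}(ū)` is decrypted componentwise to `ū` by some key of `K`.
[Goldreich 2004, Def. 5.1.1 (2), Def. 5.2.8] [cite: Goldreich2004, Def. 5.1.1] -/
theorem toOuterMeasure_encVecPMF_dec_eq_one {S : SKEScheme} (hS : S.IsCorrect) (n : ℕ)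
    (us : List (List Bool)) (K : Finset (List Bool)) (hK : (S.keyPMF n).support ⊆ ↑K) :
    (S.encVecPMF n us).toOuterMeasure
        ((encodingList Bool).listBool.encode ''
          {cs | ∃ k' ∈ K, List.Forall₂ (fun c u => S.dec k' c = some u) cs us}) = 1 := by
  rw [toOuterMeasure_encVecPMF_image]
  have hk : ∀ k, S.keyPMF n k * (S.ctVecPMF k us).toOuterMeasure
      {cs | ∃ k' ∈ K, List.Forall₂ (fun c u => S.dec k' c = some u) cs us} = S.keyPMF n k := by
    intro k
    by_cases hmem : k ∈ (S.keyPMF n).support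
    · have h1 : (S.ctVecPMF k us).toOuterMeasure
          {cs | ∃ k' ∈ K, List.Forall₂ (fun c u => S.dec k' c = some u) cs us} = 1 := by
        refine le_antisymm (((S.ctVecPMF k us).toOuterMeasure.mono (Set.subset_univ _)).trans_eq
          ((PMF.toOuterMeasure_apply_eq_one_iff _ _).2 (Set.subset_univ _))) ?_
        rw [← toOuterMeasure_ctVecPMF_dec_eq_one hS hmem us]
        refine (S.ctVecPMF k us).toOuterMeasure_mono fun cs hcs => ?_
        exact ⟨k, hK hmem, hcs.1⟩
      rw [h1, mul_one]
    · rw [(PMF.apply_eq_zero_iff _ _).2 hmem, zero_mul]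
  rw [tsum_congr hk, PMF.tsum_coe]

/-- **The key space is small**: the range of `G(1ⁿ)` is contained in a finite set of at most
`2^{q(n)}` strings, `q(n)` the number of coins of `G` on `1ⁿ` (keys are a function of the coins).
[Goldreich 2004, §5.5.7 Exercise 2 guideline ("`Kₙ` may contain at most `n` bits of
information"); Arora–Barak 2009, proof of Lemma 9.2 (`|S| ≤ 2ⁿ`)] [cite: AroraBarak2009, Lemma 9.2 (proof)] -/
theorem exists_finset_keyPMF_support (n : ℕ) :
    ∃ K : Finset (List Bool), (S.keyPMF n).support ⊆ ↑K ∧ K.card ≤ 2 ^ S.keyGen.coinLen n := by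
  classical
  have hn : (unaryEncodeNat n).length = n := unary_decode_encode_nat n
  refine ⟨Finset.univ.image fun r : List.Vector Bool (S.keyGen.coinLen (unaryEncodeNat n).length) =>
      S.keyGen.run n r.toList, ?_, ?_⟩
  · intro k hk
    unfold keyPMF RandAlg.outputPMF at hk
    rw [PMF.support_map] at hk
    obtain ⟨r, -, rfl⟩ := hk
    simp only [Finset.coe_image, Finset.coe_univ, Set.image_univ, Set.mem_range,
      exists_apply_eq_apply]
  · refine Finset.card_image_le.trans ?_
    rw [Finset.card_univ, card_vector, Fintype.card_bool, hn]

/-! ### Statistical distance between the two message vectors -/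

/-- **Multiple encryptions under short keys are statistically far apart** (quantitative form):
for a correct scheme, pairwise distinct plaintexts `ū = (u₁, …, u_t)`, a plaintext `v`, and any
finite `K ⊇ supp G(1ⁿ)`,
`Δ(Ē_{G(1ⁿ)}(ū), Ē_{G(1ⁿ)}(v, …, v)) ≥ 1 − |K|·t⁻ᵗ` — the event "some key of `K` decrypts every
component to `uᵢ`" has probability `1` on the left and `≤ |K| t⁻ᵗ` on the right.
[Shannon 1949, §10 Thm. 6 and §§14–15; Goldreich 2004, §5.5.7 Exercise 2 (guideline: the
ensembles "are statistically far apart"); Arora–Barak 2009, Lemma 9.2 (proof)] [folklore] -/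
theorem le_tvDist_encVecPMF {S : SKEScheme} (hS : S.IsCorrect) (n : ℕ) (v : List Bool)
    (us : List (List Bool)) (hus : us.Nodup) (K : Finset (List Bool))
    (hK : (S.keyPMF n).support ⊆ ↑K) :
    1 - K.card * ((us.length : ℝ)⁻¹) ^ us.length ≤
      (S.encVecPMF n us).tvDist (S.encVecPMF n (List.replicate us.length v)) := by
  set E : Set (List Bool) := (encodingList Bool).listBool.encode ''
    {cs | ∃ k' ∈ K, List.Forall₂ (fun c u => S.dec k' c = some u) cs us} with hE
  have h1 : ((S.encVecPMF n us).toOuterMeasure E).toReal = 1 := by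
    rw [hE, toOuterMeasure_encVecPMF_dec_eq_one hS n us K hK, ENNReal.toReal_one]
  have hb : 0 ≤ ((us.length : ℝ)⁻¹) ^ us.length := by positivity
  have h2 : ((S.encVecPMF n (List.replicate us.length v)).toOuterMeasure E).toReal ≤
      K.card * ((us.length : ℝ)⁻¹) ^ us.length := by
    refine ENNReal.toReal_le_of_le_ofReal (by positivity) ?_
    rw [ENNReal.ofReal_mul (Nat.cast_nonneg _), ENNReal.ofReal_natCast]
    exact S.toOuterMeasure_encVecPMF_spurious_le n v us hus K
  rw [PMF.tvDist_eq_iSup_measure_holds]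
  have hbdd : BddAbove (Set.range fun T : Set (List Bool) =>
      ((S.encVecPMF n us).toOuterMeasure T).toReal -
        ((S.encVecPMF n (List.replicate us.length v)).toOuterMeasure T).toReal) := by
    refine ⟨1, ?_⟩
    rintro _ ⟨T, rfl⟩
    have hp : ((S.encVecPMF n us).toOuterMeasure T).toReal ≤ 1 :=
      ENNReal.toReal_le_of_le_ofReal zero_le_one
        (by
          rw [ENNReal.ofReal_one]
          exact ((S.encVecPMF n us).toOuterMeasure.mono (Set.subset_univ T)).trans_eq
            ((PMF.toOuterMeasure_apply_eq_one_iff _ _).2 (Set.subset_univ _)))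
    linarith [ENNReal.toReal_nonneg
      (a := (S.encVecPMF n (List.replicate us.length v)).toOuterMeasure T)]
  refine le_trans ?_ (le_ciSup hbdd E)
  change 1 - (K.card : ℝ) * ((us.length : ℝ)⁻¹) ^ us.length ≤
    ((S.encVecPMF n us).toOuterMeasure E).toReal -
      ((S.encVecPMF n (List.replicate us.length v)).toOuterMeasure E).toReal
  rw [h1]
  linarith

/-- `t⁻ᵗ ≤ 2⁻ᵗ` for `t ≥ 2`. [folklore] -/
private theorem inv_pow_self_le_inv_two_pow {t : ℕ} (ht : 2 ≤ t) :
    ((t : ℝ)⁻¹) ^ t ≤ ((2 : ℝ)⁻¹) ^ t := by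
  refine pow_le_pow_left₀ (by positivity) ?_ t
  exact inv_anti₀ two_pos (by exact_mod_cast ht)

/-- **`q(n) + 2` messages suffice for distance `3/4`**: for a correct scheme whose key generator
tosses `q(n)` coins on `1ⁿ`, any `t ≥ q(n) + 2` pairwise distinct plaintexts `ū` and any plaintext
`v`, `Δ(Ē_{G(1ⁿ)}(ū), Ē_{G(1ⁿ)}(v, …, v)) ≥ 3/4` (as `2^{q(n)} t⁻ᵗ ≤ 2^{q(n)} 2⁻ᵗ ≤ 1/4`). When the `uᵢ`
all have the length of `v` the two message vectors have the same length profile, so for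
`t, |v|` polynomial in `n` this is an admissible pair of the multiple-message game of
`HasIndMultipleEncryptions`, which therefore never holds statistically: the Impagliazzo–Luby
hypothesis `SecureSKEExist` is purely computational (cf. Arora–Barak 2009, Lemma 9.2: it fails if
`P = NP`). [Shannon 1949, §10 Thm. 6; Arora–Barak 2009, §9.1–9.2, Lemma 9.2; Goldreich 2004,
§5.5.7 Exercises 2–3] [folklore] -/
theorem three_quarters_le_tvDist_encVecPMF {S : SKEScheme} (hS : S.IsCorrect) (n : ℕ)
    (v : List Bool) (us : List (List Bool)) (hus : us.Nodup)
    (ht : S.keyGen.coinLen n + 2 ≤ us.length) :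
    (3 / 4 : ℝ) ≤ (S.encVecPMF n us).tvDist (S.encVecPMF n (List.replicate us.length v)) := by
  obtain ⟨K, hK, hcard⟩ := S.exists_finset_keyPMF_support n
  refine le_trans ?_ (le_tvDist_encVecPMF hS n v us hus K hK)
  set q := S.keyGen.coinLen n with hq
  set t := us.length with htdef
  have hcardR : (K.card : ℝ) ≤ 2 ^ q := by exact_mod_cast hcard
  have h2t : 2 ≤ t := le_trans (by omega) ht
  have hpow : ((t : ℝ)⁻¹) ^ t ≤ ((2 : ℝ)⁻¹) ^ t := inv_pow_self_le_inv_two_pow h2t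
  have hmono : ((2 : ℝ)⁻¹) ^ t ≤ ((2 : ℝ)⁻¹) ^ (q + 2) :=
    pow_le_pow_of_le_one (by positivity) (by norm_num) ht
  have hkey : (2 : ℝ) ^ q * ((2 : ℝ)⁻¹) ^ (q + 2) = 1 / 4 := by
    rw [pow_add, inv_pow, inv_pow, ← mul_assoc, mul_inv_cancel₀ (by positivity)]
    norm_num
  have hb : 0 ≤ ((t : ℝ)⁻¹) ^ t := by positivity
  have : (K.card : ℝ) * ((t : ℝ)⁻¹) ^ t ≤ 1 / 4 :=
    calc (K.card : ℝ) * ((t : ℝ)⁻¹) ^ t ≤ 2 ^ q * ((t : ℝ)⁻¹) ^ t :=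
          mul_le_mul_of_nonneg_right hcardR hb
      _ ≤ 2 ^ q * ((2 : ℝ)⁻¹) ^ (q + 2) :=
          mul_le_mul_of_nonneg_left (hpow.trans hmono) (by positivity)
      _ = 1 / 4 := hkey
  linarith

/-- The message vectors of `three_quarters_le_tvDist_encVecPMF` have the same length profile when
every `uᵢ` has the length of `v` (admissibility in the multiple-message game, Def. 5.2.8:
`|x̄| = |ȳ|` componentwise). [Goldreich 2004, Def. 5.2.8] [cite: Goldreich2004, Def. 5.2.8] -/
theorem map_length_eq_replicate (v : List Bool) (us : List (List Bool))
    (h : ∀ u ∈ us, u.length = v.length) :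
    us.map List.length = (List.replicate us.length v).map List.length := by
  rw [List.map_replicate]
  exact List.eq_replicate_iff.2 ⟨List.length_map _, fun b hb => by
    obtain ⟨u, hu, rfl⟩ := List.mem_map.1 hb
    exact h u hu⟩

end SKEScheme

end Literature.Computability.Cryptography
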